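import Literature.MathematicalPhysics.QuantumFieldTheory.Balaban1983to89.Node00.SmallFieldChiOfRecord
import Literature.MathematicalPhysics.QuantumFieldTheory.Balaban1983to89.Node00.Record11

/-!
# YM-DAG node N21 (= NE7c) AT THE RECORD's OWN SLOT TEST: the small-field characteristic function OF RECORD
# `Node00.chiOfRecord` ([Balaban1988Convergent] (2.17) p. 257, def-R's Stage-7 pin, inherited by NODE 00's Stage-11 record
# `Node00.IsRecordOfRecord₁₁C` through `Stage11Params.ν`) READ AS N21's SLOT MODEL — a finite product over the record's
# `LM₂R_k`-cube family of cube slot indicators `chiSmall (p ⊂ □^∼) (ε_k(g_k)η_k²) (U_{k,□}(V))` — and the TWO-RUN MISMATCH of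
# such products covered slot by slot by SINGLE-RUN shells written in the record's own currency «χ at a raised threshold minus
# χ at a lowered threshold» (the lowered-threshold device of [Balaban1989LargeFieldI] p. 193)

Track A of `YM-PLAN.md` (cell `pub-ymgap`, HUMAN RULING D-0062), node **N21**; R134 acceleration seat `pub-ymgap-dag-n21-d`
(strategy s2: N21's statement of record `T4IndicatorShell.ShellWeightBound` «at explicit carriers → the ₁₁ record»), successor of
the dag-n21-a lineage (files 1–9, p408928 … p420189).  Kernel bookkeeping BY NAME over def-R's `Node00/SmallFieldChiOfRecord.lean`
(`chiOfRecord`, `epsOfRecord`, `RkOfRecord`, `cubeIndices`, `cubeSide`, `cubeEnl`, `plaqInside`, `bgOfRecord`), r11's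
`B14.Eq216Concrete.chi217 ∕ ukBox` and `Setup`'s `chiSmall ∕ PlaqSmallOn`; 0 `def`, 0 `sorry`, standard axioms; COUNT-NEUTRAL;
`--supports` the K3 item `SpineGivenEndpointR11` (stmt-QuantumFields-19676).

WHY THIS MODULE (the s2 census, 2026-08-26).  The literal s2 row «`S_N21 SRec` at the rate-record home ∕ ₁₁, one application per
reading predicate» is NOT typable today: no instance of `YMDAG.UVSplit.SpineRecordPred` exists (every tree occurrence is a
parameter; `Record11` ∕ `Record11Carriers(B8)` pin the DENSITY tower's §2 form and the leaf carriers, not a loop string's term classes),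
and the one road-I letter a record could pin for N21 — the rate base `ϑ = L^{−1∕6}` — is FAMILY-level (`T4Family.L`), already in the
scope of every K5 reading predicate of `BalabanUVNodesN21AtSpineCarriers` (p417321).  What the record DOES pin, and what the N21
lineage had not read, is the SLOT TEST ITSELF: since Stage 7 the tower's small-field characteristic functions are the total
definition `Node00.chiOfRecord F N ν g K k` = r11's (2.17) product, over ALL cubes `□` of the `L^{k+1}M₂R_k`-partition of `T_η`, of the
indicators `χ({sup_{p ⊂ □^∼} |U_{k,□}(V)(∂p) − 1| < ε_kη²})` at the LOCAL backgrounds (2.16) `U_{k,□}(V) = ukBox …` and the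
COUPLING-DEPENDENT threshold `ε_k = ε(g_k) = g_k A₀ (log g_k⁻²)^{p₀}` ((2.4) p. 255, `epsOfRecord`).  N21's shells are «the parts of the
terms on which the two runs' indicator products DISAGREE» (`N21-PIN-LIST.md` §0); this module proves, at these objects, the
indicator-level half of that carving.

WHAT IS PROVED ([folklore] bookkeeping; nothing of Bałaban's asserted).
* §1 DEF-FREE SHELLS in `Setup.chiSmall` currency.  `chiSmall S δ U` is monotone in the threshold; for two configurations `U`,
  `U′` whose plaquette variables on `S` are `Δ`-close, the two mismatch pieces `χ_δ(U)(1 − χ_δ(U′))` and `(1 − χ_δ(U))χ_δ(U′)` are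
  dominated by the SINGLE-RUN bands `χ_δ(U) − χ_{δ−Δ}(U)` and `χ_{δ+Δ}(U) − χ_δ(U)` — so `|χ_δ(U) − χ_δ(U′)| ≤ χ_{δ+Δ}(U) − χ_{δ−Δ}(U)`
  (the VARIABLE band, width `Δ`: in-edge N16's two-run closeness); for one configuration and two thresholds
  `|χ_δ(U) − χ_{δ′}(U)| = χ_{δ∨δ′}(U) − χ_{δ∧δ′}(U)` (the THRESHOLD band); both at once: `abs_chiSmall_two_le_bands`.
* §2 THE COMMON-REFINEMENT COVER over an arbitrary `Finset` (design (i) of `T4IndicatorShell`, whose §2 telescopes over `range n`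
  only): `|∏ a − ∏ b| ≤ Σ |a − b|` for factors of modulus `≤ 1`.
* §3 r11's (2.17) product `chi217`: two fields, two thresholds, ONE cube family ⇒ the mismatch is covered by the sum over the cubes
  of (threshold band + variable band), every band a single-run (run A) slot indicator difference.
* §4 AT THE RECORD: the same for `Node00.chiOfRecord F N ν g K k` vs `Node00.chiOfRecord F N ν g′ K k` at two fields `V`, `V′` on run
  A's level-`k` lattice (run B READ on that lattice, as dag-n21-a's `W = rescale L (bavg L U_B)`, p410611) — under TWO DISPLAYED
  hypotheses: (N16 at the record's objects) the per-cube, per-plaquette closeness `Δ` of the two fields' LOCAL backgrounds (2.16);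
  (SYNC) the two coupling sequences give the SAME `R_k` ((2.5) p. 255: `R_k = L^{s(g_k)}` is a step function of the coupling), hence the
  same cube partition.  Twin over the Stage-11 parameters `θ : Node00.Stage11Params F N` (`ν := θ.ν`), the numerics a ₁₁ record
  certifies.
* §5 THE THRESHOLD PROFILE of record: `0 < g ≤ g′ ≤ 1`, `0 ≤ A₀` ⇒ `ε(g′) ≤ (g′∕g)·ε(g)`, so the threshold band's upper excursion is
  `≤ ((g′ − g)∕g)·ε(g)` relative — fed by the two-run COUPLING discrepancy.

TWO LOCATED FINDINGS (for dag-lead, the `SRec` author, dag-n21-c; stated here, not discharged).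
(L1) THRESHOLD MISMATCH.  At matched levels the two runs test at `ε(g^A_k)η²` vs `ε(g^B_{k+1})η²` (after dag-n21-a's η-synchronisation,
`smallInd_scaled`); the thresholds of record are coupling-dependent, the runs' couplings differ, so the N21 shell must absorb the band
between them — dag-n21-a's junctions (files 3∕6∕7) are stated «at ANY COMMON threshold `t`» and are silent on it.  Its relative width
is controlled by node U2 ∕ N17's two-run coupling discrepancy (`Spine.NE4.U2Output`: `|1∕(g^A_k)² − 1∕(g^B_{k+1})²|` along tuned
runs) through §5: an IN-EDGE U2 ∕ N17 → N21 AT THE RECORD, not in YM-PLAN §2c's list (n12, n16, n20).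
(L2) CUBE-PARTITION SYNC.  Where `(log g⁻²)^r` crosses a power of `L` between the two runs' couplings, the (2.17) partitions differ by a
factor `L`; the mismatch is then a background-LOCALITY width ([Balaban1988Convergent] (2.16), [Balaban1989LargeFieldI] (1.74) species),
not a threshold shell — displayed as the hypothesis `hR` of §4.

HONEST FRAMING.  NE7c is NOT PRINTED and NOT PROVED; the weights (terms `T, A, B` of the dressed partition functions, NODE O ∕ N27x)
are not here, so no `ShellWeightBound` is concluded — this is the INDICATOR-LEVEL cover at the record's objects that a `SlotLedger.cover`
field integrates; the closeness `Δ` and the sync `hR` are hypotheses; nothing of Bałaban's is asserted or instantiated; typed 28∕28,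
discharged count untouched; one finite four-torus programme at fixed `ε` — NOT ℝ⁴, NOT infinite volume, NOT OS, NOT a mass gap, NOT
Clay.  Restate-immune (no Theses file imported).  No decl below carries a cite tag.
-/

noncomputable section

open scoped BigOperators

namespace Summit.QuantumFields.YangMills.Theorems.N21SlotTestAtRecord

open Literature.MathematicalPhysics.QuantumFieldTheory.Balaban1983to89
open Literature.MathematicalPhysics.QuantumFieldTheory.Balaban1983to89.GaugeField (plaqHol)
open Literature.MathematicalPhysics.QuantumFieldTheory.Balaban1983to89.B15DeterminingSets (DetBackground)
open Literature.MathematicalPhysics.QuantumFieldTheory.Balaban1983to89.B14.Eq216Concrete (ukBox chi217 chi217_apply)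
open Finset

/-! ## §1 Def-free shells in `chiSmall` currency: threshold monotonicity, the variable band, the threshold band -/

section ChiSmall

variable {P : Params} {j : ℕ} {G : Type*} [GaugeGroup G] (S : Set (Plaq P j))

/-- `χ_δ(U) ∈ {0, 1}`, hence `0 ≤ χ_δ(U)`. [bookkeeping] -/
theorem chiSmall_nonneg' (δ : ℝ) (U : GaugeField P j G) : 0 ≤ chiSmall S δ U := by
  unfold chiSmall; split_ifs <;> norm_num

/-- … and `χ_δ(U) ≤ 1`. [bookkeeping] -/
theorem chiSmall_le_one' (δ : ℝ) (U : GaugeField P j G) : chiSmall S δ U ≤ 1 := by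
  unfold chiSmall; split_ifs <;> norm_num

/-- `|χ_δ(U)| ≤ 1`. [bookkeeping] -/
theorem abs_chiSmall_le_one (δ : ℝ) (U : GaugeField P j G) : |chiSmall S δ U| ≤ 1 :=
  abs_le.mpr ⟨by linarith [chiSmall_nonneg' S δ U], chiSmall_le_one' S δ U⟩

/-- **THRESHOLD MONOTONICITY**: a small-field indicator can only grow when its threshold is raised, `δ ≤ δ′ ⇒ χ_δ(U) ≤ χ_{δ′}(U)`.
[bookkeeping] -/
theorem chiSmall_mono_threshold {δ δ' : ℝ} (h : δ ≤ δ') (U : GaugeField P j G) : chiSmall S δ U ≤ chiSmall S δ' U := by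
  by_cases hU : PlaqSmallOn S δ U
  · have hU' : PlaqSmallOn S δ' U := fun p hp => lt_of_lt_of_le (hU p hp) h
    simp only [chiSmall, if_pos hU, if_pos hU', le_refl]
  · simp only [chiSmall, if_neg hU]
    split_ifs <;> norm_num

/-- A band `χ_{δ′}(U) − χ_δ(U)`, `δ ≤ δ′`, is nonnegative. [bookkeeping] -/
theorem chiSmall_band_nonneg {δ δ' : ℝ} (h : δ ≤ δ') (U : GaugeField P j G) : 0 ≤ chiSmall S δ' U - chiSmall S δ U :=
  sub_nonneg.mpr (chiSmall_mono_threshold S h U)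

variable {S}

/-- **MISMATCH PIECE 1 ≤ THE BAND BELOW.**  If the plaquette variables of `U` and `U′` on `S` are `Δ`-close, then «`U` small at `δ`,
`U′` not» forces some plaquette of `U` into `[δ − Δ, δ)`: `χ_δ(U)(1 − χ_δ(U′)) ≤ χ_δ(U) − χ_{δ−Δ}(U)` — a SINGLE-RUN shell of `U` below
its threshold, of width `Δ`, written as «χ at the threshold minus χ at the lowered threshold». [bookkeeping] -/
theorem chiSmall_mul_one_sub_chiSmall_le_band {δ Δ : ℝ} {U U' : GaugeField P j G}
    (hΔ : ∀ p ∈ S, |dist1 (plaqHol U p) - dist1 (plaqHol U' p)| ≤ Δ) :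
    chiSmall S δ U * (1 - chiSmall S δ U') ≤ chiSmall S δ U - chiSmall S (δ - Δ) U := by
  by_cases hU : PlaqSmallOn S δ U
  · by_cases hU' : PlaqSmallOn S δ U'
    · simp only [chiSmall, if_pos hU, if_pos hU']
      split_ifs <;> norm_num
    · -- some `p ∈ S` has `δ ≤ |U′(∂p) − 1|`, hence `δ − Δ ≤ |U(∂p) − 1|`: `U` is NOT small at the lowered threshold
      have hlow : ¬ PlaqSmallOn S (δ - Δ) U := by
        intro hl
        apply hU'
        intro p hp
        have h1 := hl p hp
        have h2 := (abs_le.mp (hΔ p hp)).1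
        by_contra hn
        push Not at hn
        linarith
      simp only [chiSmall, if_pos hU, if_neg hU', if_neg hlow]
      norm_num
  · have hlow : ¬ PlaqSmallOn S (δ - Δ) U := by
      intro hl
      apply hU
      intro p hp
      have h0 : 0 ≤ Δ := (abs_nonneg _).trans (hΔ p hp)
      linarith [hl p hp]
    simp only [chiSmall, if_neg hU, if_neg hlow]
    norm_num

/-- **MISMATCH PIECE 2 ≤ THE BAND ABOVE.**  Under the same closeness, «`U` not small at `δ`, `U′` small» forces every plaquette of `U`
below `δ + Δ`: `(1 − χ_δ(U))χ_δ(U′) ≤ χ_{δ+Δ}(U) − χ_δ(U)`. [bookkeeping] -/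
theorem one_sub_chiSmall_mul_chiSmall_le_band {δ Δ : ℝ} {U U' : GaugeField P j G}
    (hΔ : ∀ p ∈ S, |dist1 (plaqHol U p) - dist1 (plaqHol U' p)| ≤ Δ) :
    (1 - chiSmall S δ U) * chiSmall S δ U' ≤ chiSmall S (δ + Δ) U - chiSmall S δ U := by
  by_cases hU' : PlaqSmallOn S δ U'
  · have hup : PlaqSmallOn S (δ + Δ) U := by
      intro p hp
      have h1 := hU' p hp
      have h2 := (abs_le.mp (hΔ p hp)).2
      linarith
    simp only [chiSmall, if_pos hU', if_pos hup]
    split_ifs <;> norm_num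
  · have h0 : 0 ≤ Δ := by
      obtain ⟨p, hp, -⟩ : ∃ p ∈ S, ¬ dist1 (plaqHol U' p) < δ := by
        by_contra hn
        push Not at hn
        exact hU' hn
      exact (abs_nonneg _).trans (hΔ p hp)
    simp only [chiSmall, if_neg hU', mul_zero]
    exact chiSmall_band_nonneg S (by linarith) U

/-- **THE VARIABLE BAND.**  For `Δ`-close plaquette variables on `S`: `|χ_δ(U) − χ_δ(U′)| ≤ χ_{δ+Δ}(U) − χ_{δ−Δ}(U)` — the two-run
mismatch of ONE slot indicator lies in a single-run shell of `U` of width `Δ` on either side of the threshold (the indicator-level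
content of `T4IndicatorShell.smallInd_mul_one_sub_le` ∕ dag-n21-a's `slot_shell_domination`, in the record's `chiSmall` currency and
without a `sup`). [bookkeeping] -/
theorem abs_chiSmall_sub_chiSmall_le_band {δ Δ : ℝ} {U U' : GaugeField P j G}
    (hΔ : ∀ p ∈ S, |dist1 (plaqHol U p) - dist1 (plaqHol U' p)| ≤ Δ) :
    |chiSmall S δ U - chiSmall S δ U'| ≤ chiSmall S (δ + Δ) U - chiSmall S (δ - Δ) U := by
  have h1 := chiSmall_mul_one_sub_chiSmall_le_band (δ := δ) hΔ
  have h2 := one_sub_chiSmall_mul_chiSmall_le_band (δ := δ) hΔ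
  have hx0 := chiSmall_nonneg' S δ U
  have hx1 := chiSmall_le_one' S δ U
  have hy0 := chiSmall_nonneg' S δ U'
  have hy1 := chiSmall_le_one' S δ U'
  -- for `x, y ∈ [0, 1]`: `|x − y| ≤ x(1 − y) + (1 − x)y`
  have key : |chiSmall S δ U - chiSmall S δ U'| ≤
      chiSmall S δ U * (1 - chiSmall S δ U') + (1 - chiSmall S δ U) * chiSmall S δ U' := by
    rw [abs_le]
    constructor <;> nlinarith
  linarith

/-- **THE THRESHOLD BAND.**  One configuration, two thresholds: `|χ_δ(U) − χ_{δ′}(U)| = χ_{δ∨δ′}(U) − χ_{δ∧δ′}(U)`. [bookkeeping] -/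
theorem abs_chiSmall_thresholds_eq_band (δ δ' : ℝ) (U : GaugeField P j G) :
    |chiSmall S δ U - chiSmall S δ' U| = chiSmall S (max δ δ') U - chiSmall S (min δ δ') U := by
  rcases le_total δ δ' with h | h
  · rw [max_eq_right h, min_eq_left h, abs_sub_comm]
    exact abs_of_nonneg (chiSmall_band_nonneg S h U)
  · rw [max_eq_left h, min_eq_right h]
    exact abs_of_nonneg (chiSmall_band_nonneg S h U)

/-- **BOTH BANDS.**  Two configurations with `Δ`-close plaquette variables on `S`, tested at two thresholds `δ` (run A) and `δ′` (run B):
`|χ_δ(U) − χ_{δ′}(U′)| ≤ (χ_{δ∨δ′}(U) − χ_{δ∧δ′}(U)) + (χ_{δ′+Δ}(U) − χ_{δ′−Δ}(U))` — threshold band plus variable band, BOTH single-run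
shells of `U`. [bookkeeping] -/
theorem abs_chiSmall_two_le_bands {δ δ' Δ : ℝ} {U U' : GaugeField P j G}
    (hΔ : ∀ p ∈ S, |dist1 (plaqHol U p) - dist1 (plaqHol U' p)| ≤ Δ) :
    |chiSmall S δ U - chiSmall S δ' U'| ≤
      (chiSmall S (max δ δ') U - chiSmall S (min δ δ') U) + (chiSmall S (δ' + Δ) U - chiSmall S (δ' - Δ) U) := by
  calc |chiSmall S δ U - chiSmall S δ' U'|
      ≤ |chiSmall S δ U - chiSmall S δ' U| + |chiSmall S δ' U - chiSmall S δ' U'| := abs_sub_le _ _ _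
    _ ≤ _ := add_le_add (abs_chiSmall_thresholds_eq_band δ δ' U).le (abs_chiSmall_sub_chiSmall_le_band hΔ)

end ChiSmall

/-! ## §2 The common-refinement cover over an arbitrary finite slot family -/

/-- **`|∏ a − ∏ b| ≤ Σ |a − b|`** for two families of reals of modulus `≤ 1` over any `Finset` (design (i) «common refinement» of
`T4IndicatorShell`, which telescopes over `range n`; here by induction on the finset). [bookkeeping] -/
theorem abs_prod_sub_prod_le_sum_abs {α : Type*} (s : Finset α) (a b : α → ℝ) (ha : ∀ i ∈ s, |a i| ≤ 1)
    (hb : ∀ i ∈ s, |b i| ≤ 1) : |∏ i ∈ s, a i - ∏ i ∈ s, b i| ≤ ∑ i ∈ s, |a i - b i| := by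
  classical
  induction s using Finset.induction_on with
  | empty => simp
  | @insert i s hi ih =>
    have ha' : ∀ x ∈ s, |a x| ≤ 1 := fun x hx => ha x (mem_insert_of_mem hx)
    have hb' : ∀ x ∈ s, |b x| ≤ 1 := fun x hx => hb x (mem_insert_of_mem hx)
    have hai : |a i| ≤ 1 := ha i (mem_insert_self i s)
    have hB : |∏ x ∈ s, b x| ≤ 1 := by
      rw [Finset.abs_prod]
      exact prod_le_one (fun x _ => abs_nonneg _) hb'
    rw [prod_insert hi, prod_insert hi, sum_insert hi]
    have hsplit : a i * ∏ x ∈ s, a x - b i * ∏ x ∈ s, b x =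
        a i * (∏ x ∈ s, a x - ∏ x ∈ s, b x) + (a i - b i) * ∏ x ∈ s, b x := by ring
    rw [hsplit]
    calc |a i * (∏ x ∈ s, a x - ∏ x ∈ s, b x) + (a i - b i) * ∏ x ∈ s, b x|
        ≤ |a i * (∏ x ∈ s, a x - ∏ x ∈ s, b x)| + |(a i - b i) * ∏ x ∈ s, b x| := abs_add_le _ _
      _ = |a i| * |∏ x ∈ s, a x - ∏ x ∈ s, b x| + |a i - b i| * |∏ x ∈ s, b x| := by rw [abs_mul, abs_mul]
      _ ≤ 1 * (∑ x ∈ s, |a x - b x|) + |a i - b i| * 1 :=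
          add_le_add (mul_le_mul hai (ih ha' hb') (abs_nonneg _) zero_le_one)
            (mul_le_mul_of_nonneg_left hB (abs_nonneg _))
      _ = |a i - b i| + ∑ x ∈ s, |a x - b x| := by ring

/-! ## §3 r11's (2.17) product `chi217`: two fields, two thresholds, one cube family -/

section Chi217

variable {P : Params} {G : Type*} [GaugeGroup G] {av : ∀ j, Averaging P j G} (bg : DetBackground P G av) (M₁ : ℕ)
  {ι : Type*} (X : Finset ι) (plaqT : ι → Set (Plaq P 0)) (enl4 : ι → Set (Site P 0))

/-- **THE TWO-RUN MISMATCH OF (2.17) PRODUCTS IS COVERED SLOT BY SLOT.**  Two fields `V`, `V′` on the level-`k` lattice and two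
threshold letters `ε`, `ε′`, ONE cube family `X` with its plaquette sets `p ⊂ □^∼` and domains `□^{∼4}`; DISPLAYED: for every cube the
plaquette variables of the two LOCAL backgrounds (2.16) `U_{k,□}(V)`, `U_{k,□}(V′)` are `Δ`-close on `□^∼`.  THEN
`|χ_k^{ε}(V) − χ_k^{ε′}(V′)| ≤ Σ_{□ ∈ X} ((χ_□^{εη²∨ε′η²} − χ_□^{εη²∧ε′η²})(U_{k,□}V) + (χ_□^{ε′η²+Δ} − χ_□^{ε′η²−Δ})(U_{k,□}V))` — every
summand a single-run (run A) slot band. [bookkeeping] -/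
theorem abs_chi217_sub_chi217_le_sum_bands (εk εk' : ℝ) (k : ℕ) (V V' : GaugeField P k G) {Δ : ℝ}
    (hΔ : ∀ c ∈ X, ∀ p ∈ plaqT c,
      |dist1 (plaqHol (ukBox bg M₁ (enl4 c) k V) p) - dist1 (plaqHol (ukBox bg M₁ (enl4 c) k V') p)| ≤ Δ) :
    |chi217 bg M₁ X plaqT enl4 εk k V - chi217 bg M₁ X plaqT enl4 εk' k V'| ≤
      ∑ c ∈ X,
        ((chiSmall (plaqT c) (max (εk * P.eta k ^ 2) (εk' * P.eta k ^ 2)) (ukBox bg M₁ (enl4 c) k V) -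
            chiSmall (plaqT c) (min (εk * P.eta k ^ 2) (εk' * P.eta k ^ 2)) (ukBox bg M₁ (enl4 c) k V)) +
          (chiSmall (plaqT c) (εk' * P.eta k ^ 2 + Δ) (ukBox bg M₁ (enl4 c) k V) -
            chiSmall (plaqT c) (εk' * P.eta k ^ 2 - Δ) (ukBox bg M₁ (enl4 c) k V))) := by
  rw [chi217_apply, chi217_apply]
  refine (abs_prod_sub_prod_le_sum_abs X _ _ (fun c _ => abs_chiSmall_le_one _ _ _)
    (fun c _ => abs_chiSmall_le_one _ _ _)).trans (sum_le_sum fun c hc => ?_)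
  exact abs_chiSmall_two_le_bands (hΔ c hc)

end Chi217

/-! ## §4 AT THE RECORD: `Node00.chiOfRecord` — N21's slot test of record, and the two-run cover under closeness + sync -/

section AtRecord

open Node00

variable (F : T4Continuum.T4Family) (N : ℕ) [NeZero N]

/-- **N21's SLOT MODEL OF RECORD (reading).**  The record's `χ_k(T_η)` along the coupling sequence `g` IS the finite product, over
the record's cube family (side `L^{k+1}M₂R_k`, `R_k = RkOfRecord L r g_k`), of the cube slot indicators
`chiSmall (p ⊂ □^∼) (ε(g_k)·η_k²) (U_{k,□}(V))` at the (2.12)-solution datum of record — slots = cubes, slot test = «all plaquettes of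
`□^∼` small for the local background», threshold = the COUPLING-DEPENDENT `epsOfRecord ν g k · η_k²` (`chiOfRecord_eq_chi217` and
`chi217_apply`, definitional). [bookkeeping] -/
theorem chiOfRecord_eq_prod_slots (ν : Stage7Numerics) (g : ℕ → ℝ) (K k : ℕ) (V : GaugeField (F.P K) k (SU N)) :
    chiOfRecord F N ν g K k V =
      ∏ a ∈ cubeIndices (F.P K) (cubeSide (F.P K).L ν.M₂ (RkOfRecord (F.P K).L ν.r (g k)) k),
        chiSmall (plaqInside (cubeEnl (F.P K) (cubeSide (F.P K).L ν.M₂ (RkOfRecord (F.P K).L ν.r (g k)) k) a 1))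
          (epsOfRecord ν g k * (F.P K).eta k ^ 2)
          (ukBox (bgOfRecord (avOfRecord F N K) {U | PlaqSmall (ν.εreg * (F.P K).eta k ^ 2) U}) ν.M₁
            (cubeEnl (F.P K) (cubeSide (F.P K).L ν.M₂ (RkOfRecord (F.P K).L ν.r (g k)) k) a 4) k V) := by
  rw [chiOfRecord_eq_chi217, chi217_apply]

/-- **THE TWO-RUN MISMATCH OF THE RECORD's SMALL-FIELD FUNCTIONS IS COVERED BY SINGLE-RUN SLOT BANDS.**  Two fields `V`, `V′` on
run A's level-`k` lattice `GaugeField (F.P K) k (SU N)` (run B read there) and two coupling sequences `g`, `g′`; DISPLAYED: (SYNC)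
`R_k(g_k) = R_k(g′_k)` — the two (2.17) cube partitions coincide; (N16 at the record's objects) for every cube `□` of the record's
family the plaquette variables of the local backgrounds `U_{k,□}(V)`, `U_{k,□}(V′)` are `Δ`-close on `□^∼`.  THEN
`|χ_k^{rec}(g)(V) − χ_k^{rec}(g′)(V′)| ≤ Σ_□ (threshold band between `ε(g_k)η²` and `ε(g′_k)η²` + variable band of width `Δ` about
`ε(g′_k)η²`)`, every band the difference of two of the RECORD's OWN slot indicators of run A at shifted thresholds. [bookkeeping] -/
theorem abs_chiOfRecord_sub_chiOfRecord_le_sum_slotBands (ν : Stage7Numerics) (g g' : ℕ → ℝ) (K k : ℕ)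
    (hR : RkOfRecord (F.P K).L ν.r (g k) = RkOfRecord (F.P K).L ν.r (g' k)) (V V' : GaugeField (F.P K) k (SU N)) {Δ : ℝ}
    (hΔ : ∀ a ∈ cubeIndices (F.P K) (cubeSide (F.P K).L ν.M₂ (RkOfRecord (F.P K).L ν.r (g k)) k),
      ∀ p ∈ plaqInside (cubeEnl (F.P K) (cubeSide (F.P K).L ν.M₂ (RkOfRecord (F.P K).L ν.r (g k)) k) a 1),
        |dist1 (plaqHol (ukBox (bgOfRecord (avOfRecord F N K) {U | PlaqSmall (ν.εreg * (F.P K).eta k ^ 2) U}) ν.M₁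
              (cubeEnl (F.P K) (cubeSide (F.P K).L ν.M₂ (RkOfRecord (F.P K).L ν.r (g k)) k) a 4) k V) p) -
          dist1 (plaqHol (ukBox (bgOfRecord (avOfRecord F N K) {U | PlaqSmall (ν.εreg * (F.P K).eta k ^ 2) U}) ν.M₁
              (cubeEnl (F.P K) (cubeSide (F.P K).L ν.M₂ (RkOfRecord (F.P K).L ν.r (g k)) k) a 4) k V') p)| ≤ Δ) :
    |chiOfRecord F N ν g K k V - chiOfRecord F N ν g' K k V'| ≤
      ∑ a ∈ cubeIndices (F.P K) (cubeSide (F.P K).L ν.M₂ (RkOfRecord (F.P K).L ν.r (g k)) k),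
        ((chiSmall (plaqInside (cubeEnl (F.P K) (cubeSide (F.P K).L ν.M₂ (RkOfRecord (F.P K).L ν.r (g k)) k) a 1))
              (max (epsOfRecord ν g k * (F.P K).eta k ^ 2) (epsOfRecord ν g' k * (F.P K).eta k ^ 2))
              (ukBox (bgOfRecord (avOfRecord F N K) {U | PlaqSmall (ν.εreg * (F.P K).eta k ^ 2) U}) ν.M₁
                (cubeEnl (F.P K) (cubeSide (F.P K).L ν.M₂ (RkOfRecord (F.P K).L ν.r (g k)) k) a 4) k V) -
            chiSmall (plaqInside (cubeEnl (F.P K) (cubeSide (F.P K).L ν.M₂ (RkOfRecord (F.P K).L ν.r (g k)) k) a 1))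
              (min (epsOfRecord ν g k * (F.P K).eta k ^ 2) (epsOfRecord ν g' k * (F.P K).eta k ^ 2))
              (ukBox (bgOfRecord (avOfRecord F N K) {U | PlaqSmall (ν.εreg * (F.P K).eta k ^ 2) U}) ν.M₁
                (cubeEnl (F.P K) (cubeSide (F.P K).L ν.M₂ (RkOfRecord (F.P K).L ν.r (g k)) k) a 4) k V)) +
          (chiSmall (plaqInside (cubeEnl (F.P K) (cubeSide (F.P K).L ν.M₂ (RkOfRecord (F.P K).L ν.r (g k)) k) a 1))
              (epsOfRecord ν g' k * (F.P K).eta k ^ 2 + Δ)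
              (ukBox (bgOfRecord (avOfRecord F N K) {U | PlaqSmall (ν.εreg * (F.P K).eta k ^ 2) U}) ν.M₁
                (cubeEnl (F.P K) (cubeSide (F.P K).L ν.M₂ (RkOfRecord (F.P K).L ν.r (g k)) k) a 4) k V) -
            chiSmall (plaqInside (cubeEnl (F.P K) (cubeSide (F.P K).L ν.M₂ (RkOfRecord (F.P K).L ν.r (g k)) k) a 1))
              (epsOfRecord ν g' k * (F.P K).eta k ^ 2 - Δ)
              (ukBox (bgOfRecord (avOfRecord F N K) {U | PlaqSmall (ν.εreg * (F.P K).eta k ^ 2) U}) ν.M₁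
                (cubeEnl (F.P K) (cubeSide (F.P K).L ν.M₂ (RkOfRecord (F.P K).L ν.r (g k)) k) a 4) k V))) := by
  rw [chiOfRecord_eq_chi217, chiOfRecord_eq_chi217, ← hR]
  exact abs_chi217_sub_chi217_le_sum_bands _ _ _ _ _ _ _ k V V' hΔ

/-- **THE STAGE-11 FACE.**  A Stage-11 record `Node00.IsRecordOfRecord₁₁C F N D w` certifies parameters `θ : Node00.Stage11Params F N`
whose Stage-7 numerics `θ.ν` (`M₁, M₂, r, p₀, A₀, εreg`) are the letters N21's slot test of record reads; the cover of
`abs_chiOfRecord_sub_chiOfRecord_le_sum_slotBands` at `ν := θ.ν`, stated with the sum abbreviated by its defining bound (the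
right-hand side is the one displayed there). [bookkeeping] -/
theorem abs_chiOfRecord_sub_le_sum_slotBands_stage11 (θ : Stage11Params F N) (g g' : ℕ → ℝ) (K k : ℕ)
    (hR : RkOfRecord (F.P K).L θ.ν.r (g k) = RkOfRecord (F.P K).L θ.ν.r (g' k)) (V V' : GaugeField (F.P K) k (SU N)) {Δ : ℝ}
    (hΔ : ∀ a ∈ cubeIndices (F.P K) (cubeSide (F.P K).L θ.ν.M₂ (RkOfRecord (F.P K).L θ.ν.r (g k)) k),
      ∀ p ∈ plaqInside (cubeEnl (F.P K) (cubeSide (F.P K).L θ.ν.M₂ (RkOfRecord (F.P K).L θ.ν.r (g k)) k) a 1),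
        |dist1 (plaqHol (ukBox (bgOfRecord (avOfRecord F N K) {U | PlaqSmall (θ.ν.εreg * (F.P K).eta k ^ 2) U}) θ.ν.M₁
              (cubeEnl (F.P K) (cubeSide (F.P K).L θ.ν.M₂ (RkOfRecord (F.P K).L θ.ν.r (g k)) k) a 4) k V) p) -
          dist1 (plaqHol (ukBox (bgOfRecord (avOfRecord F N K) {U | PlaqSmall (θ.ν.εreg * (F.P K).eta k ^ 2) U}) θ.ν.M₁
              (cubeEnl (F.P K) (cubeSide (F.P K).L θ.ν.M₂ (RkOfRecord (F.P K).L θ.ν.r (g k)) k) a 4) k V') p)| ≤ Δ)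
    {B : ℝ}
    (hB : ∑ a ∈ cubeIndices (F.P K) (cubeSide (F.P K).L θ.ν.M₂ (RkOfRecord (F.P K).L θ.ν.r (g k)) k),
        ((chiSmall (plaqInside (cubeEnl (F.P K) (cubeSide (F.P K).L θ.ν.M₂ (RkOfRecord (F.P K).L θ.ν.r (g k)) k) a 1))
              (max (epsOfRecord θ.ν g k * (F.P K).eta k ^ 2) (epsOfRecord θ.ν g' k * (F.P K).eta k ^ 2))
              (ukBox (bgOfRecord (avOfRecord F N K) {U | PlaqSmall (θ.ν.εreg * (F.P K).eta k ^ 2) U}) θ.ν.M₁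
                (cubeEnl (F.P K) (cubeSide (F.P K).L θ.ν.M₂ (RkOfRecord (F.P K).L θ.ν.r (g k)) k) a 4) k V) -
            chiSmall (plaqInside (cubeEnl (F.P K) (cubeSide (F.P K).L θ.ν.M₂ (RkOfRecord (F.P K).L θ.ν.r (g k)) k) a 1))
              (min (epsOfRecord θ.ν g k * (F.P K).eta k ^ 2) (epsOfRecord θ.ν g' k * (F.P K).eta k ^ 2))
              (ukBox (bgOfRecord (avOfRecord F N K) {U | PlaqSmall (θ.ν.εreg * (F.P K).eta k ^ 2) U}) θ.ν.M₁
                (cubeEnl (F.P K) (cubeSide (F.P K).L θ.ν.M₂ (RkOfRecord (F.P K).L θ.ν.r (g k)) k) a 4) k V)) +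
          (chiSmall (plaqInside (cubeEnl (F.P K) (cubeSide (F.P K).L θ.ν.M₂ (RkOfRecord (F.P K).L θ.ν.r (g k)) k) a 1))
              (epsOfRecord θ.ν g' k * (F.P K).eta k ^ 2 + Δ)
              (ukBox (bgOfRecord (avOfRecord F N K) {U | PlaqSmall (θ.ν.εreg * (F.P K).eta k ^ 2) U}) θ.ν.M₁
                (cubeEnl (F.P K) (cubeSide (F.P K).L θ.ν.M₂ (RkOfRecord (F.P K).L θ.ν.r (g k)) k) a 4) k V) -
            chiSmall (plaqInside (cubeEnl (F.P K) (cubeSide (F.P K).L θ.ν.M₂ (RkOfRecord (F.P K).L θ.ν.r (g k)) k) a 1))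
              (epsOfRecord θ.ν g' k * (F.P K).eta k ^ 2 - Δ)
              (ukBox (bgOfRecord (avOfRecord F N K) {U | PlaqSmall (θ.ν.εreg * (F.P K).eta k ^ 2) U}) θ.ν.M₁
                (cubeEnl (F.P K) (cubeSide (F.P K).L θ.ν.M₂ (RkOfRecord (F.P K).L θ.ν.r (g k)) k) a 4) k V))) ≤ B) :
    |chiOfRecord F N θ.ν g K k V - chiOfRecord F N θ.ν g' K k V'| ≤ B :=
  (abs_chiOfRecord_sub_chiOfRecord_le_sum_slotBands F N θ.ν g g' K k hR V V' hΔ).trans hB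

end AtRecord

/-! ## §5 The threshold profile of record: one-sided relative Lipschitz bound in the coupling (feeds (L1)) -/

section Profile

open Node00

/-- The profile `p₀(g) = A₀ (log g⁻²)^{p₀}` is ANTITONE in the coupling on `(0, 1]` (`A₀ ≥ 0`): a larger coupling has a smaller
logarithm. [bookkeeping] -/
theorem p0Profile_anti {A₀ : ℝ} (hA₀ : 0 ≤ A₀) (p₀ : ℕ) {g g' : ℝ} (hg : 0 < g) (hgg' : g ≤ g') (hg' : g' ≤ 1) :
    p0Profile A₀ p₀ g' ≤ p0Profile A₀ p₀ g := by
  unfold p0Profile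
  have hg'0 : 0 < g' := lt_of_lt_of_le hg hgg'
  have hsq : g ^ 2 ≤ g' ^ 2 := by nlinarith
  have hsq' : g' ^ 2 ≤ 1 := by nlinarith
  have hinv : (g' ^ 2)⁻¹ ≤ (g ^ 2)⁻¹ := inv_anti₀ (by positivity) hsq
  have hone : 1 ≤ (g' ^ 2)⁻¹ := one_le_inv_iff₀.mpr ⟨by positivity, hsq'⟩
  have hlog0 : 0 ≤ Real.log (g' ^ 2)⁻¹ := Real.log_nonneg hone
  have hlog : Real.log (g' ^ 2)⁻¹ ≤ Real.log (g ^ 2)⁻¹ := Real.log_le_log (by positivity) hinv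
  exact mul_le_mul_of_nonneg_left (pow_le_pow_left₀ hlog0 hlog p₀) hA₀

/-- **ONE-SIDED RELATIVE BOUND OF THE THRESHOLD OF RECORD IN THE COUPLING**: along two coupling sequences with `0 < g_k ≤ g′_k ≤ 1`
(`A₀ ≥ 0`), `ε(g′_k) ≤ (g′_k ∕ g_k)·ε(g_k)`. [bookkeeping] -/
theorem epsOfRecord_le_div_mul_epsOfRecord (ν : Stage7Numerics) (hA₀ : 0 ≤ ν.A₀) {g g' : ℕ → ℝ} {k : ℕ} (hg : 0 < g k)
    (hgg' : g k ≤ g' k) (hg' : g' k ≤ 1) : epsOfRecord ν g' k ≤ g' k / g k * epsOfRecord ν g k := by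
  unfold epsOfRecord
  have hg'0 : 0 ≤ g' k := hg.le.trans hgg'
  have hp := p0Profile_anti hA₀ ν.p₀ hg hgg' hg'
  calc g' k * p0Profile ν.A₀ ν.p₀ (g' k) ≤ g' k * p0Profile ν.A₀ ν.p₀ (g k) := mul_le_mul_of_nonneg_left hp hg'0
    _ = g' k / g k * (g k * p0Profile ν.A₀ ν.p₀ (g k)) := by field_simp

/-- … hence the threshold band's UPPER excursion is at most `((g′_k − g_k) ∕ g_k)·ε(g_k)` — relative width fed by the two-run COUPLING
discrepancy (node U2 ∕ N17), the located in-edge (L1). [bookkeeping] -/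
theorem epsOfRecord_sub_le (ν : Stage7Numerics) (hA₀ : 0 ≤ ν.A₀) {g g' : ℕ → ℝ} {k : ℕ} (hg : 0 < g k) (hgg' : g k ≤ g' k)
    (hg' : g' k ≤ 1) : epsOfRecord ν g' k - epsOfRecord ν g k ≤ (g' k - g k) / g k * epsOfRecord ν g k := by
  have h := epsOfRecord_le_div_mul_epsOfRecord ν hA₀ hg hgg' hg'
  have hid : (g' k - g k) / g k * epsOfRecord ν g k = g' k / g k * epsOfRecord ν g k - epsOfRecord ν g k := by
    rw [sub_div, div_self hg.ne', sub_mul, one_mul]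
  rw [hid]
  linarith

end Profile

end Summit.QuantumFields.YangMills.Theorems.N21SlotTestAtRecord

end
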